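/-
Copyright: the b2b-balaban cell (near-miss cell 7), T⁴-continuum fan-out, NE7b ROUND-2 swarm seat
`t4-ne7b-formalise-leaf-06` (row S5 of the lineage `t4-ne7b-p1` claim table `LEAVES-NE7b.md`).
Released under the licence of the surrounding project.
-/
import Summits.QuantumFields.BalabanUV.T4Continuum.Support.ZoneReading

/-!
# History chronology (leaf H2c): the merger-dating invariant that makes a genealogy `Chrono`

Summits-side support leaf of the T⁴-continuum cell (rung (B)+1 on a FINITE torus only; NOT infinite volume, NOT the
mass gap, NOT the Clay statement; NOT a proof of the spine estimate NE7b).  Row S5 «H2c chronology» of the ROUND-2 swarm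
table `t4/b2b-balaban-t4-ne7b-p1/LEAVES-NE7b.md` (skeleton `SKELETON-NE7b-P1.md` §2 H2c, trigger `T4-NE7b-TRIGGER.json`
conditions c1–c6).  [folklore] finite combinatorics over the lineage's OWN typed carrier `T4PersistenceDictionary.Gen`;
nothing is quoted from print, nothing printed is asserted, no `[cite:]` tag, no `def … : Prop` fact (c1).

WHY.  The zone-multiplicity factor of the labelled shape `HistorySocket.shapeZ` is paid by
`ZoneReading.card_admZSet_le_of_reading`, whose hypothesis `ZoneSkeleton.Chrono PEv.step G` («at every merger every
FORMATION event — birth or merger — of the two partners is dated no later than the merger event») is NOT implied by the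
dictionary's admissibility `T4PrintedShapeBanking.Consistent` (a merger node only requires its date to lie in both
partners' pending lives, so a sub-merger of a partner may be dated LATER than the node above it: §4 decides such a
genealogy).  For histories READ OFF A PROCESS it holds for the plain reason that a structure assembled at stage `n`
consists of events of stages `≤ n`: in Bałaban's inductive description the components of `Z_{j+1}` arise from components
of `Z_j` and new regions of step `j + 1` «joined together … by the operations of the last step» (B16 p. 386, CONTEXT
only; binary mergers along a maximal tree, all dated `j + 1`).  This leaf isolates that reason as a typed invariant so
that the chronology of the swarm's `HistoryGen.liveGen` (row S3) is ONE instantiation: whoever builds a `Gen` stage by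
stage, merging at stage `n` only structures whose events are dated `≤ n` with a merger event dated `n`, gets `Chrono`.

WHAT.  §1 `EventsLE st n G` (all events dated `≤ n`) and **`Timely st G`** (at every merger node the merger event is
dated no earlier than EVERY event of the two partners) with `simp` API; **`chrono_of_timely`** (`Timely → Chrono`, as
formation events are events).  §2 the STAGE INVARIANT `Staged st n G := Timely st G ∧ EventsLE st n G`: born ∕ renew ∕
merge rules, monotonicity in `n`, and the fold rules `Staged.foldl` ∕ `Staged.foldl_merge` ∕ `Staged.foldl_merge'` ∕
`Staged.foldr_merge` (a chain of binary mergers AT ONE STAGE of staged partners is staged) — the shape of print's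
maximal-tree reduction.  §3 structural form: `Timely.sub` (heredity along `ZoneTorus.Sub`), **`timely_iff_sub`** and
**`chrono_iff_sub`** (chronology = a condition on every merger SUB-NODE; construction-order free), transport
`timely_gmap` ∕ `timely_of_gmap` along `ZoneSkeleton.gmap` (no injectivity needed).  §4 Sanity (decided): a
`Consistent`, well-formed genealogy that is NOT `Chrono`; a staged three-partner merger chain that is.  §5 (v2) the
dictionary's events under `T4PrintedShapeBanking.Consistent`: `kind_eq_two_of_mem_merges` ∕ `kind_ne_zero_of_mem_merges`
(the hypothesis `hk2` of `ZoneReading.card_admZSet_le_of_reading`; its `hk0` is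
`PartnerMultiplicityG.kind_eq_zero_of_mem_births`), `eventsLE_of_consistent` (all events dated `≤ K`),
`staged_of_consistent_timely`.

NOT DONE HERE (row S5's remaining line, by name): `chrono_liveGen : Chrono PEv.step (HistoryGen.liveGen h X)` — the
instantiation of §2 on row S3's `liveGen`, appended to this file when `Support/HistoryGen.lean` is in the tree.  NE7b
discharge: no date.

HONEST DEPENDENCY (cell): continuum YM on T⁴ ⇐ BetaPertH ∧ nine spine estimates (0/9 proved); BetaPertH ⇐ (D1) ∧ (D4)
∧ CAP+tail.  This file changes none of it.
-/

open Finset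
open Literature.MathematicalPhysics.QuantumFieldTheory.Balaban1983to89
open T4PersistenceDictionary
open Summit.QuantumFields.BalabanUV.T4Continuum.PlacementSkeleton
open Summit.QuantumFields.BalabanUV.T4Continuum.Crowding
open Summit.QuantumFields.BalabanUV.T4Continuum.ZoneSkeleton
open Summit.QuantumFields.BalabanUV.T4Continuum.ZoneTorus

namespace Summit.QuantumFields.BalabanUV.T4Continuum.HistoryChrono

variable {ε ε' : Type*} [DecidableEq ε] [DecidableEq ε']

/-! ## §1 Dated events, timely genealogies, and `Timely → Chrono` -/

section Timely

/-- **EVENTS DATED NO LATER THAN `n`**: every event of `G` has date `st w ≤ n`. [folklore] -/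
def EventsLE (st : ε → ℕ) (n : ℕ) : Gen ε → Prop := fun G => ∀ w ∈ G.events, st w ≤ n

/-- later bounds are weaker [folklore] -/
theorem EventsLE.mono {st : ε → ℕ} {m n : ℕ} (h : m ≤ n) {G : Gen ε} (hG : EventsLE st m G) : EventsLE st n G :=
  fun w hw => (hG w hw).trans h

/-- dated events of a bare birth [folklore] -/
@[simp] theorem eventsLE_born (st : ε → ℕ) (n : ℕ) (b : ε) (j : ℕ) : EventsLE st n (Gen.born b j) ↔ st b ≤ n := by
  simp [EventsLE]

/-- dated events after a renewal [folklore] -/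
@[simp] theorem eventsLE_renew (st : ε → ℕ) (n : ℕ) (G : Gen ε) (e : ε) (h : ℕ) :
    EventsLE st n (Gen.renew G e h) ↔ st e ≤ n ∧ EventsLE st n G := by
  simp [EventsLE]

/-- dated events after a merger [folklore] -/
@[simp] theorem eventsLE_merge (st : ε → ℕ) (n : ℕ) (X Y : Gen ε) (e : ε) :
    EventsLE st n (Gen.merge X Y e) ↔ st e ≤ n ∧ EventsLE st n X ∧ EventsLE st n Y := by
  simp [EventsLE, or_imp, forall_and]

/-- the root birth is dated no later than any event bound (the root is an event) [folklore] -/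
theorem EventsLE.root_le {st : ε → ℕ} {n : ℕ} {G : Gen ε} (hG : EventsLE st n G) : st G.root ≤ n :=
  hG _ G.root_mem

/-- … and so is the last event [folklore] -/
theorem EventsLE.top_le {st : ε → ℕ} {n : ℕ} {G : Gen ε} (hG : EventsLE st n G) : st G.top ≤ n :=
  hG _ G.top_mem

/-- **TIMELY GENEALOGIES**: at every merger node the merger event is dated no earlier than EVERY event (births,
renewals, sub-mergers) of the two partners.  The invariant of a genealogy assembled along a process; strictly stronger
than `Chrono` (which dates only the partners' formation events). [folklore] -/
def Timely (st : ε → ℕ) : Gen ε → Prop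
  | Gen.born _ _ => True
  | Gen.renew G _ _ => Timely st G
  | Gen.merge X Y e => Timely st X ∧ Timely st Y ∧ ∀ w ∈ X.events ∪ Y.events, st w ≤ st e

/-- a bare birth is timely [folklore] -/
@[simp] theorem timely_born (st : ε → ℕ) (b : ε) (j : ℕ) : Timely st (Gen.born b j) := trivial

/-- a renewal is timely iff the renewed structure is [folklore] -/
@[simp] theorem timely_renew (st : ε → ℕ) (G : Gen ε) (e : ε) (h : ℕ) :
    Timely st (Gen.renew G e h) ↔ Timely st G := Iff.rfl

/-- a merger is timely iff both partners are and all their events are dated no later than the merger [folklore] -/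
theorem timely_merge (st : ε → ℕ) (X Y : Gen ε) (e : ε) :
    Timely st (Gen.merge X Y e) ↔ Timely st X ∧ Timely st Y ∧ EventsLE st (st e) X ∧ EventsLE st (st e) Y := by
  simp only [Timely, EventsLE, mem_union, or_imp, forall_and]

/-- **TIMELY ⟹ CHRONOLOGICAL** (formation events are events). [folklore] -/
theorem chrono_of_timely (st : ε → ℕ) : ∀ {G : Gen ε}, Timely st G → Chrono st G
  | Gen.born _ _, _ => trivial
  | Gen.renew G _ _, h => chrono_of_timely st (G := G) h
  | Gen.merge X Y e, h => by
      refine ⟨chrono_of_timely st h.1, chrono_of_timely st h.2.1, fun w hw => h.2.2 w ?_⟩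
      rcases mem_union.1 hw with hw | hw
      · exact mem_union_left _ (form_subset_events X hw)
      · exact mem_union_right _ (form_subset_events Y hw)

end Timely

/-! ## §2 The stage invariant: assembling stage by stage yields timely genealogies -/

section Staged

/-- **STAGED AT `n`**: timely, with every event dated `≤ n` — the invariant of «the structure as it stands after the
operations of step `n`». [folklore] -/
def Staged (st : ε → ℕ) (n : ℕ) : Gen ε → Prop := fun G => Timely st G ∧ EventsLE st n G

/-- a staged genealogy is timely [folklore] -/
theorem Staged.timely {st : ε → ℕ} {n : ℕ} {G : Gen ε} (h : Staged st n G) : Timely st G := h.1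

/-- a staged genealogy is chronological [folklore] -/
theorem Staged.chrono {st : ε → ℕ} {n : ℕ} {G : Gen ε} (h : Staged st n G) : Chrono st G := chrono_of_timely st h.1

/-- … and has its events dated `≤ n` [folklore] -/
theorem Staged.eventsLE {st : ε → ℕ} {n : ℕ} {G : Gen ε} (h : Staged st n G) : EventsLE st n G := h.2

/-- stages are monotone [folklore] -/
theorem Staged.mono {st : ε → ℕ} {m n : ℕ} (hmn : m ≤ n) {G : Gen ε} (h : Staged st m G) : Staged st n G :=
  ⟨h.1, h.2.mono hmn⟩

/-- a birth dated `≤ n` is staged at `n` [folklore] -/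
theorem staged_born {st : ε → ℕ} {n : ℕ} {b : ε} (hb : st b ≤ n) (j : ℕ) : Staged st n (Gen.born b j) :=
  ⟨trivial, (eventsLE_born st n b j).2 hb⟩

/-- a renewal dated `≤ n` of a structure staged at `n` is staged at `n` [folklore] -/
theorem Staged.renew {st : ε → ℕ} {n : ℕ} {G : Gen ε} (hG : Staged st n G) {e : ε} (he : st e ≤ n) (h : ℕ) :
    Staged st n (Gen.renew G e h) :=
  ⟨(timely_renew st G e h).2 hG.1, (eventsLE_renew st n G e h).2 ⟨he, hG.2⟩⟩

/-- **THE MERGER RULE**: two structures staged at the merger's date merge into a structure staged at that date.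
[folklore] -/
theorem Staged.merge {st : ε → ℕ} {X Y : Gen ε} {e : ε} (hX : Staged st (st e) X) (hY : Staged st (st e) Y) :
    Staged st (st e) (Gen.merge X Y e) :=
  ⟨(timely_merge st X Y e).2 ⟨hX.1, hY.1, hX.2, hY.2⟩, (eventsLE_merge st (st e) X Y e).2 ⟨le_rfl, hX.2, hY.2⟩⟩

/-- the merger rule with the stage named: partners staged at `n`, merger dated exactly `n` [folklore] -/
theorem Staged.merge_eq {st : ε → ℕ} {n : ℕ} {X Y : Gen ε} {e : ε} (hX : Staged st n X) (hY : Staged st n Y)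
    (he : st e = n) : Staged st n (Gen.merge X Y e) := by
  subst he; exact hX.merge hY

/-- a generic fold preserving the stage invariant [folklore] -/
theorem Staged.foldl {α : Type*} {st : ε → ℕ} {n : ℕ} (step : Gen ε → α → Gen ε) (P : α → Prop)
    (hstep : ∀ G a, Staged st n G → P a → Staged st n (step G a)) :
    ∀ (l : List α) {G : Gen ε}, Staged st n G → (∀ a ∈ l, P a) → Staged st n (l.foldl step G)
  | [], _, hG, _ => hG
  | a :: l, _, hG, hl =>
      Staged.foldl step P hstep l (hstep _ a hG (hl a (by simp))) fun b hb => hl b (by simp [hb])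

/-- **A CHAIN OF BINARY MERGERS AT ONE STAGE** (print's maximal-tree reduction, accumulator on the left): folding
`merge acc Z e` over partners `Z` staged at `n` with merger events dated `n` keeps the accumulator staged at `n`.
[folklore] -/
theorem Staged.foldl_merge {st : ε → ℕ} {n : ℕ} (l : List (Gen ε × ε)) {G : Gen ε} (hG : Staged st n G)
    (hl : ∀ p ∈ l, Staged st n p.1 ∧ st p.2 = n) :
    Staged st n (l.foldl (fun acc p => Gen.merge acc p.1 p.2) G) :=
  Staged.foldl (fun acc (p : Gen ε × ε) => Gen.merge acc p.1 p.2) (fun p => Staged st n p.1 ∧ st p.2 = n)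
    (fun _ _ hacc hp => hacc.merge_eq hp.1 hp.2) l hG hl

/-- … accumulator on the right of each merger [folklore] -/
theorem Staged.foldl_merge' {st : ε → ℕ} {n : ℕ} (l : List (Gen ε × ε)) {G : Gen ε} (hG : Staged st n G)
    (hl : ∀ p ∈ l, Staged st n p.1 ∧ st p.2 = n) :
    Staged st n (l.foldl (fun acc p => Gen.merge p.1 acc p.2) G) :=
  Staged.foldl (fun acc (p : Gen ε × ε) => Gen.merge p.1 acc p.2) (fun p => Staged st n p.1 ∧ st p.2 = n)
    (fun _ _ hacc hp => hp.1.merge_eq hacc hp.2) l hG hl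

/-- … and the right fold [folklore] -/
theorem Staged.foldr_merge {st : ε → ℕ} {n : ℕ} :
    ∀ (l : List (Gen ε × ε)) {G : Gen ε}, Staged st n G → (∀ p ∈ l, Staged st n p.1 ∧ st p.2 = n) →
      Staged st n (l.foldr (fun p acc => Gen.merge p.1 acc p.2) G)
  | [], _, hG, _ => hG
  | p :: l, _, hG, hl => by
      rw [List.foldr_cons]
      have hp := hl p (by simp)
      exact hp.1.merge_eq (Staged.foldr_merge l hG fun q hq => hl q (by simp [hq])) hp.2

end Staged

/-! ## §3 Structural form: heredity, the sub-node characterisations, transport -/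

section Structural

/-- timeliness descends to sub-structures [folklore] -/
theorem Timely.sub {st : ε → ℕ} : ∀ {X G : Gen ε}, Sub X G → Timely st G → Timely st X
  | _, _, Sub.refl _, h => h
  | _, _, Sub.renew _ _ hs, h => Timely.sub hs h
  | _, _, Sub.left _ _ hs, h => Timely.sub hs h.1
  | _, _, Sub.right _ _ hs, h => Timely.sub hs h.2.1

/-- dated events descend to sub-structures [folklore] -/
theorem EventsLE.sub {st : ε → ℕ} {n : ℕ} {X G : Gen ε} (hs : Sub X G) (h : EventsLE st n G) : EventsLE st n X :=
  fun w hw => h w (events_subset_of_sub hs hw)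

/-- the stage invariant descends to sub-structures [folklore] -/
theorem Staged.sub {st : ε → ℕ} {n : ℕ} {X G : Gen ε} (hs : Sub X G) (h : Staged st n G) : Staged st n X :=
  ⟨h.1.sub hs, h.2.sub hs⟩

/-- **TIMELINESS IS A CONDITION ON THE MERGER SUB-NODES**: `G` is timely iff at every merger sub-node both partners'
events are dated no later than that merger.  (Construction-order free.) [folklore] -/
theorem timely_iff_sub {st : ε → ℕ} {G : Gen ε} :
    Timely st G ↔ ∀ X Y e, Sub (Gen.merge X Y e) G → EventsLE st (st e) X ∧ EventsLE st (st e) Y := by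
  constructor
  · intro h X Y e hs
    have hm := (timely_merge st X Y e).1 (h.sub hs)
    exact ⟨hm.2.2.1, hm.2.2.2⟩
  · induction G with
    | born b j => exact fun _ => trivial
    | renew G e h ih => exact fun H => (timely_renew st G e h).2 (ih fun X Y e' hs => H X Y e' (Sub.renew e h hs))
    | merge X Y e ihX ihY =>
        intro H
        refine (timely_merge st X Y e).2 ⟨ihX fun A B e' hs => H A B e' (Sub.left Y e hs),
          ihY fun A B e' hs => H A B e' (Sub.right X e hs), ?_⟩
        exact H X Y e (Sub.refl _)

/-- **CHRONOLOGY IS A CONDITION ON THE MERGER SUB-NODES**: `G` is `Chrono` iff at every merger sub-node the partners'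
formation events are dated no later than that merger. [folklore] -/
theorem chrono_iff_sub {st : ε → ℕ} {G : Gen ε} :
    Chrono st G ↔ ∀ X Y e, Sub (Gen.merge X Y e) G → ∀ w ∈ form X ∪ form Y, st w ≤ st e := by
  constructor
  · intro h X Y e hs
    exact (chrono_of_sub st hs h).2.2
  · induction G with
    | born b j => exact fun _ => trivial
    | renew G e h ih => exact fun H => ih fun X Y e' hs => H X Y e' (Sub.renew e h hs)
    | merge X Y e ihX ihY =>
        intro H
        exact ⟨ihX fun A B e' hs => H A B e' (Sub.left Y e hs), ihY fun A B e' hs => H A B e' (Sub.right X e hs),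
          H X Y e (Sub.refl _)⟩

/-- dated events push forward along a relabelling of events (dates read through the map) [folklore] -/
theorem eventsLE_gmap (f : ε → ε') (st' : ε' → ℕ) (n : ℕ) (G : Gen ε) :
    EventsLE st' n (gmap f G) ↔ EventsLE (st' ∘ f) n G := by
  simp only [EventsLE, events_gmap, mem_image, forall_exists_index, and_imp, forall_apply_eq_imp_iff₂,
    Function.comp_apply]

/-- **TIMELINESS PUSHES FORWARD** along any relabelling of events: `Timely (st' ∘ f) G → Timely st' (gmap f G)`.
[folklore] -/
theorem timely_gmap (f : ε → ε') (st' : ε' → ℕ) : ∀ {G : Gen ε}, Timely (st' ∘ f) G → Timely st' (gmap f G)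
  | Gen.born _ _, _ => trivial
  | Gen.renew G e h, hG => (timely_renew st' (gmap f G) (f e) h).2 (timely_gmap f st' (G := G) hG)
  | Gen.merge X Y e, hG => by
      obtain ⟨hX, hY, hXe, hYe⟩ := (timely_merge (st' ∘ f) X Y e).1 hG
      exact (timely_merge st' (gmap f X) (gmap f Y) (f e)).2 ⟨timely_gmap f st' hX, timely_gmap f st' hY,
        (eventsLE_gmap f st' _ X).2 hXe, (eventsLE_gmap f st' _ Y).2 hYe⟩

/-- … and descends: `Timely st' (gmap f G) → Timely (st' ∘ f) G`. [folklore] -/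
theorem timely_of_gmap (f : ε → ε') (st' : ε' → ℕ) : ∀ {G : Gen ε}, Timely st' (gmap f G) → Timely (st' ∘ f) G
  | Gen.born _ _, _ => trivial
  | Gen.renew G e h, hG => (timely_renew (st' ∘ f) G e h).2
      (timely_of_gmap f st' (G := G) ((timely_renew st' (gmap f G) (f e) h).1 hG))
  | Gen.merge X Y e, hG => by
      obtain ⟨hX, hY, hXe, hYe⟩ := (timely_merge st' (gmap f X) (gmap f Y) (f e)).1 hG
      exact (timely_merge (st' ∘ f) X Y e).2 ⟨timely_of_gmap f st' hX, timely_of_gmap f st' hY,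
        (eventsLE_gmap f st' _ X).1 hXe, (eventsLE_gmap f st' _ Y).1 hYe⟩

/-- the stage invariant pushes forward [folklore] -/
theorem staged_gmap (f : ε → ε') (st' : ε' → ℕ) {n : ℕ} {G : Gen ε} (h : Staged (st' ∘ f) n G) :
    Staged st' n (gmap f G) :=
  ⟨timely_gmap f st' h.1, (eventsLE_gmap f st' n G).2 h.2⟩

end Structural

/-! ## §4 Sanity (decided): `Consistent ∧ WF` does not give `Chrono`; a staged merger chain does -/

namespace Sanity

open T4PrintedShapeBanking

/-- Model constants for the sanity checks (only `n₁ = 1` matters: merger window `n₁ + R s = 2`). [folklore] -/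
def C₀ : T4PrintedShapeBanking.Consts :=
  { n₁ := 1, dC := 1, q' := 1, E₂ := 1, E₃ := 1, κ₁ := 1, E₀ := 1, Eb := 1, μ := 1, a := 1, A₀ := 1, p₀ := 1 }

/-- THE NON-CHRONOLOGICAL CONSISTENT GENEALOGY: three regions `b₀ b₁ b₂` born at step `0` (fatness classes `0, 1, 2`
to keep the events distinct; birth windows `fatWait d′ + R 0 + 1 = 3` for the run `R ≡ 1`, lives `[0, 3)`), the
sub-merger `X = merge b₀ b₁ m` dated `m.step = 1` (life of `X`: `[0, 3 + (n₁ + R 1)) = [0, 5)`) and the top merger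
`merge X b₂ m'` dated `m'.step = 0` — EARLIER than the sub-merger below it.  `Consistent` at cutoff `K = 1` (each
merger date lies in both partners' pending lives) and well formed, but not `Chrono`. [folklore] -/
def bad : Gen PEv :=
  Gen.merge (Gen.merge (Gen.born (0, 0, 0) 0) (Gen.born (0, 0, 1) 0) (1, 2, 0)) (Gen.born (0, 0, 2) 0) (0, 2, 1)

/-- `bad` is consistent at cutoff `K = 1` for the run `R ≡ 1` [folklore] -/
theorem bad_consistent : Consistent C₀ 1 (fun _ => 1) bad := by
  simp [bad, Consistent, C₀, PEv.kind, PEv.step, Gen.rootStep, Gen.reach, dictW, fatWait, PEv.fat]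

/-- `bad` is well formed for the same window table [folklore] -/
theorem bad_wf : bad.WF (dictW (fun _ => 1) C₀.n₁) := by
  simp [bad, Gen.WF, C₀, Gen.rootStep, Gen.reach, dictW, fatWait, PEv.kind, PEv.fat]

/-- … and NOT chronological: the sub-merger `(1, 2, 0)` is a formation event of the first partner dated after the top
merger `(0, 2, 1)` [folklore] -/
theorem bad_not_chrono : ¬ Chrono PEv.step bad := by
  intro h
  have := h.2.2 (1, 2, 0) (by decide)
  simp [PEv.step] at this

/-- THE STAGED CHAIN: at stage `3` an old component (born at `0`, renewed at readiness `2`) absorbs two new regions of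
step `3` by two binary mergers dated `3` — staged at `3` by the fold rule, hence `Chrono`. [folklore] -/
def chain : Gen PEv :=
  [(Gen.born ((3, 0, 1) : PEv) 3, ((3, 2, 0) : PEv)), (Gen.born (3, 0, 0) 3, (3, 2, 1))].foldl
    (fun acc p => Gen.merge acc p.1 p.2) (Gen.renew (Gen.born (0, 0, 0) 0) (2, 1, 0) 1)

/-- the chain is staged at `3` (by `Staged.foldl_merge`, no unfolding of the fold) [folklore] -/
theorem chain_staged : Staged PEv.step 3 chain := by
  refine Staged.foldl_merge _ ((staged_born (by decide) 0).renew (by decide) 1) ?_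
  intro p hp
  simp only [List.mem_cons, List.not_mem_nil, or_false] at hp
  rcases hp with rfl | rfl
  · exact ⟨staged_born (by decide) 3, rfl⟩
  · exact ⟨staged_born (by decide) 3, rfl⟩

/-- … hence chronological [folklore] -/
theorem chain_chrono : Chrono PEv.step chain := chain_staged.chrono

end Sanity

/-! ## §5 (v2) The dictionary's events: kinds and dates under `Consistent` -/

section Dictionary

open T4PrintedShapeBanking

variable {C : T4PrintedShapeBanking.Consts} {K : ℕ} {R : ℕ → ℕ}

/-- **THE MERGERS OF A CONSISTENT GENEALOGY HAVE KIND `2`** (the companion of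
`PartnerMultiplicityG.kind_eq_zero_of_mem_births`). [folklore] -/
theorem kind_eq_two_of_mem_merges : ∀ {G : Gen PEv}, Consistent C K R G → ∀ m ∈ merges G, m.kind = 2
  | Gen.born b j, _, m, hm => by simp [merges] at hm
  | Gen.renew G e h, hc, m, hm => by
      simp only [Consistent] at hc
      exact kind_eq_two_of_mem_merges (G := G) hc.1 m hm
  | Gen.merge X Y e, hc, m, hm => by
      simp only [Consistent] at hc
      simp only [merges, mem_insert, mem_union] at hm
      rcases hm with rfl | hm | hm
      · exact hc.2.2.1
      · exact kind_eq_two_of_mem_merges hc.1 m hm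
      · exact kind_eq_two_of_mem_merges hc.2.1 m hm

/-- … hence are not births: the hypothesis `hk2` of `ZoneReading.card_admZSet_le_of_reading`. [folklore] -/
theorem kind_ne_zero_of_mem_merges {G : Gen PEv} (hc : Consistent C K R G) : ∀ m ∈ merges G, m.kind ≠ 0 :=
  fun m hm h => by have := kind_eq_two_of_mem_merges hc m hm; rw [h] at this; exact absurd this (by decide)

/-- **A CONSISTENT GENEALOGY AT CUTOFF `K` HAS ALL ITS EVENTS DATED `≤ K`** (births `j ≤ K`, renewals `h + 1 ≤ K`,
mergers `e.step ≤ K`). [folklore] -/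
theorem eventsLE_of_consistent : ∀ {G : Gen PEv}, Consistent C K R G → EventsLE PEv.step K G
  | Gen.born b j, hc => by
      simp only [Consistent] at hc
      obtain ⟨-, hs, hj⟩ := hc
      exact (eventsLE_born PEv.step K b j).2 (hs ▸ hj)
  | Gen.renew G e h, hc => by
      simp only [Consistent] at hc
      obtain ⟨hG, -, hs, -, hK⟩ := hc
      exact (eventsLE_renew PEv.step K G e h).2 ⟨hs ▸ hK, eventsLE_of_consistent hG⟩
  | Gen.merge X Y e, hc => by
      simp only [Consistent] at hc
      obtain ⟨hX, hY, -, -, -, -, -, hK⟩ := hc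
      exact (eventsLE_merge PEv.step K X Y e).2 ⟨hK, eventsLE_of_consistent hX, eventsLE_of_consistent hY⟩

/-- So for a consistent genealogy timeliness alone is the stage invariant at the cutoff. [folklore] -/
theorem staged_of_consistent_timely {G : Gen PEv} (hc : Consistent C K R G) (ht : Timely PEv.step G) :
    Staged PEv.step K G :=
  ⟨ht, eventsLE_of_consistent hc⟩

end Dictionary

end Summit.QuantumFields.BalabanUV.T4Continuum.HistoryChrono
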